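import Literature.Analysis.FunctionSpaces.SpinorWightmanPCTFamilies
import Literature.Analysis.FunctionSpaces.SpinorWightmanPCTIdentity
import Literature.Analysis.FunctionSpaces.SpinorWightmanPCTKinematics
import Literature.Analysis.FunctionSpaces.SpinorWightmanPCTLocality
import Literature.MathematicalPhysics.QuantumLattice.TubeNegRev
import HarnessLib

/-!
# The PCT identity for sequences of covariant families (components and adjoint components)

Topic `Literature/Analysis/FunctionSpaces`. `SpinorWightmanPCTIdentity` proves the PCT identity of
Streater–Wightman's Thm. 4-7 (1964, §4-3) for species sequences; the PCT operator `Θ` and the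
odd-Fermi-number vanishing also need it for products of members of arbitrary **covariant families**
(`SpinorWightmanPCTFamilies`: species multiplets with `R = S^{(k)}` and adjoint multiplets with
`R = S̄^{(k)}`). This file repeats the assembly for a sequence `Φ : Fin n → CovFamily W`:

* `famRelFn_boostN`, `famRelFn_rot3N` (boost/rotation covariance with `boostGroup (Φ ·).R`,
  `rotTensor (Φ ·).R` through the cover), `pctHF` / `pctDistF` (the reversed–reflected function and
  distribution via `negRev`), `famDist_reflect_eq_of_box` (WLC on a right-wedge box),
* `famRelFn_eq_pct` (`TubeBoost.pct_core_local` applied), `famDist_eq_pct'`,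
  `sum_repTensor_neg_one_pctDistF`, `famDist_eq_pct`, and on tensor products `cWightmanFn_eq_pct`:
  `𝒲_α(f) = σ ∑_β ∏ⱼ pctMatrix(Rⱼ)(αⱼ, βⱼ) 𝒲^{rev}_{β∘rev}(f̂ ∘ rev)`, `σ = (−1)^{F(F−1)/2}`.

## References

* R. F. Streater, A. S. Wightman, *PCT, Spin and Statistics, and All That* (1964; Princeton 2000),
  §4-3 Thm. 4-7, eqs. (4-19), (4-29)–(4-35). [StreaterWightman1964]
-/

noncomputable section

open Filter MeasureTheory Set ComplexConjugate Complex
open _root_.Topology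
open scoped InnerProductSpace SchwartzMap MatrixGroups Real
open Literature.MathematicalPhysics Literature.MathematicalPhysics.QuantumLattice

namespace Literature.Analysis.FunctionSpaces

variable {κ : Type*}


namespace IsSpinorWightmanQFT

open SpinorWightmanData

variable {W : SpinorWightmanData κ} {n : ℕ}

/-! ### Boost and rotation covariance of `wRelFn` in the form of `pct_core` -/

/-- **Boost covariance of the holomorphic Wightman function**:
`𝒲(B(χ) z) = (⊗ⱼ exp (χ Yⱼ)) 𝒲(z)` on `𝒯ʳₙ`. [cite: StreaterWightman1964, §4-3 eq. (4-29)] -/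
theorem famRelFn_boostN (hW : IsSpinorWightmanQFT W) (Φ : Fin n → W.CovFamily) (χ : ℝ) {z : Fin n → Fin (3 + 1) → ℂ}
    (hz : z ∈ QuantumFieldTheory.relForwardTube 3 n) :
    hW.famRelFn Φ (TubeBoost.boostN χ z) =
      boostGroup (fun j => (Φ j).R) (fun j => (Φ j).continuous_R) χ (hW.famRelFn Φ z) := by
  have hb : TubeBoost.boostN (χ : ℂ) z =
      fun j => lorentzActC (spinLorentz (SL2C.toSL SL2C.hMat SL2C.isGen_hMat (χ / 2))) (z j) := by
    funext j
    rw [TubeBoost.boostN_apply, TubeBoost.boost_ofReal_eq_lorentzActC, boost_two_eq_spinLorentz]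
  rw [hb, boostGroup_ofReal]
  funext α
  rw [hW.famRelFn_lorentz Φ _ hz α, matCLM_apply_eq_sum]
  rfl

/-- **Rotation covariance of the holomorphic Wightman function**: `𝒲(R z) = (⊗ⱼ Sⱼ(A_R)) 𝒲(z)`.
[cite: StreaterWightman1964, §4-3 eq. (4-29)] -/
theorem famRelFn_rot3N (hW : IsSpinorWightmanQFT W) (Φ : Fin n → W.CovFamily) {z : Fin n → Fin (3 + 1) → ℂ}
    (hz : z ∈ QuantumFieldTheory.relForwardTube 3 n) :
    hW.famRelFn Φ (TubeBoost.rot3N z) = rotTensor (fun j => (Φ j).R) (hW.famRelFn Φ z) := by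
  have hr : TubeBoost.rot3N z = fun j => lorentzActC (spinLorentz SL2C.rotPi) (z j) := by
    funext j; rw [TubeBoost.rot3N_apply, lorentzActC_spinLorentz_rotPi]
  rw [hr, rotTensor]
  funext α
  rw [hW.famRelFn_lorentz Φ _ hz α, matCLM_apply_eq_sum]
  rfl

/-! ### The PCT-transformed holomorphic function and distribution -/

/-- **The PCT-transformed holomorphic Wightman function** `H(z)_α = 𝒲_{k∘rev}(−z_{n−1}, …, −z₀)_{α∘rev}`.
[cite: StreaterWightman1964, §4-3 Thm 4-7] -/
def pctHF (hW : IsSpinorWightmanQFT W) (Φ : Fin n → W.CovFamily) (z : Fin n → Fin (3 + 1) → ℂ) : W.MIdxF Φ → ℂ :=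
  fun α => hW.famRelFn (fun j => Φ (Fin.rev j)) (negRev z) (W.revMIdxF Φ α)

/-- **The PCT-transformed distribution** `⟪Ω, φ_{k_{n−1}α_{n−1}}(−x_{n−1}) ⋯ φ_{k₀α₀}(−x₀) Ω⟫`:
`𝒲_{k∘rev, α∘rev} ∘ negRevTest`. [cite: StreaterWightman1964, §4-3 eq. (4-19)] -/
def pctDistF (hW : IsSpinorWightmanQFT W) (Φ : Fin n → W.CovFamily) (α : W.MIdxF Φ) : 𝓢((Fin n → SpaceTime 3), ℂ) →L[ℂ] ℂ :=
  (hW.famDist (fun j => Φ (Fin.rev j)) (W.revMIdxF Φ α)).comp negRevTest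

/-- `pctHF` is holomorphic on `𝒯ʳₙ`. [folklore] -/
theorem differentiableOn_pctHF (hW : IsSpinorWightmanQFT W) (Φ : Fin n → W.CovFamily) :
    DifferentiableOn ℂ (hW.pctHF Φ) (QuantumFieldTheory.relForwardTube 3 n) := by
  refine differentiableOn_pi.2 fun α => ?_
  exact (differentiableOn_pi.1 (hW.differentiableOn_famRelFn fun j => Φ (Fin.rev j)) (W.revMIdxF Φ α)).comp_negRev

/-- The components of `pctHF` have the boundary values `pctDistF`. [folklore] -/
theorem hasDistributionalBoundaryValue_pctHF (hW : IsSpinorWightmanQFT W) (Φ : Fin n → W.CovFamily) (α : W.MIdxF Φ) :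
    HasDistributionalBoundaryValue (fun z => hW.pctHF Φ z α) (hW.pctDistF Φ α) :=
  (hW.hasDistributionalBoundaryValue_famRelFn (fun j => Φ (Fin.rev j)) (W.revMIdxF Φ α)).comp_negRev
    fun z c => congrFun (hW.famRelFn_add_const (fun j => Φ (Fin.rev j)) z c) _

/-- **Boost covariance of `pctHF`** with the same continued boosts as `wRelFn k`. [folklore] -/
theorem pctHF_boostN (hW : IsSpinorWightmanQFT W) (Φ : Fin n → W.CovFamily) (χ : ℝ) {z : Fin n → Fin (3 + 1) → ℂ}
    (hz : z ∈ QuantumFieldTheory.relForwardTube 3 n) :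
    hW.pctHF Φ (TubeBoost.boostN χ z) = boostGroup (fun j => (Φ j).R) (fun j => (Φ j).continuous_R) χ (hW.pctHF Φ z) := by
  funext α
  simp only [pctHF]
  rw [negRev_boostN, hW.famRelFn_boostN _ χ (negRev_mem_relForwardTube hz), boostGroup_ofReal, boostGroup_ofReal,
    matCLM_apply_eq_sum, matCLM_apply_eq_sum, ← (W.revMIdxF Φ).sum_comp]
  refine Finset.sum_congr rfl fun β _ => ?_
  simp only [pctHF, repTensor_apply, revMIdxF_apply]
  rw [prod_rev_eq (fun i => (Φ i).R (SL2C.toSL SL2C.hMat SL2C.isGen_hMat (χ / 2)) (α i) (β i))]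

/-! ### The box of weak local commutativity -/

/-- **Weak local commutativity at a box of right-wedge configurations**: if the box
`{x | xⱼ ∈ Bⱼ}` lies in `𝒥⁺` and contains `x₀`, then for every compactly supported test function
`φ` supported in it, `𝒲_{k,α}(φ(−·)) = σ · 𝒲^{PCT}_{k,α}(φ)`, `σ = fermiPairSign` of the flags.
[cite: StreaterWightman1964, §4-3 Thm 4-7, eq. (4-33)] -/
theorem famDist_reflect_eq_of_box (hW : IsSpinorWightmanQFT W) (Φ : Fin n → W.CovFamily) {B : Fin n → Set (SpaceTime 3)}
    (hBo : ∀ j, IsOpen (B j)) {x₀ : Fin n → SpaceTime 3} (hx₀ : ∀ j, x₀ j ∈ B j)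
    (hB : {x : Fin n → SpaceTime 3 | ∀ j, x j ∈ B j} ⊆ TubeBoost.rightWedgeConfigs)
    (φ : 𝓢((Fin n → SpaceTime 3), ℂ)) (hφ : HasCompactSupport (φ : (Fin n → SpaceTime 3) → ℂ))
    (hφB : tsupport (φ : (Fin n → SpaceTime 3) → ℂ) ⊆ {x | ∀ j, x j ∈ B j}) (α : W.MIdxF Φ) :
    hW.famDist Φ α (TubeBoost.reflectConfigTest φ) =
      fermiPairSign (List.ofFn fun j => (Φ j).fermi) * hW.pctDistF Φ α φ := by
  set σ : ℂ := fermiPairSign (List.ofFn fun j => (Φ j).fermi) with hσ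
  set L : 𝓢((Fin n → SpaceTime 3), ℂ) →L[ℂ] ℂ := (hW.famDist Φ α).comp TubeBoost.reflectConfigTest - σ • hW.pctDistF Φ α
    with hL
  have hmain := clm_eq_zero_of_tsupport_subset_box L hBo ?_ φ hφ hφB
  · simpa [hL, sub_eq_zero] using hmain
  intro f G hG hloc
  -- the supports of the reflected factors are pairwise spacelike separated
  have hsep : ∀ ⦃a b : Fin n⦄, a < b → AreSpacelikeSeparated (tsupport (reflectTest (f a) : SpaceTime 3 → ℂ))
      (tsupport (reflectTest (f b) : SpaceTime 3 → ℂ)) := by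
    intro a b hab p hp q hq
    have hp' : -p ∈ B a := (hloc a).2 (tsupport_comp_subset_preimage (f a : SpaceTime 3 → ℂ) continuous_neg hp)
    have hq' : -q ∈ B b := (hloc b).2 (tsupport_comp_subset_preimage (f b : SpaceTime 3 → ℂ) continuous_neg hq)
    exact areSpacelikeSeparated_neg_of_box_subset hx₀ hB hab p hp' q hq'
  have h1 : hW.famDist Φ α (TubeBoost.reflectConfigTest G) = W.cWightmanFn n (fun j => (Φ j).idx (α j)) fun j => reflectTest (f j) :=
    hW.famDist_apply_of_isTensorOf Φ α hG.reflectConfigTest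
  have h3 : hW.pctDistF Φ α G =
      W.cWightmanFn n (fun j => (Φ (Fin.rev j)).idx (α (Fin.rev j))) fun j => reflectTest (f (Fin.rev j)) := by
    rw [pctDistF, ContinuousLinearMap.comp_apply, hW.famDist_apply_of_isTensorOf _ _ hG.negRevTest]
    rfl
  have hflags : (List.ofFn fun j => W.isFermi ((Φ j).idx (α j)).1) = List.ofFn fun j => (Φ j).fermi := by
    congr 1; funext j; exact (Φ j).isFermi_idx (α j)
  rw [hL, sub_apply, ContinuousLinearMap.comp_apply, smul_apply, h1, h3,
    hW.cWightmanFn_eq_fermiPairSign_mul_reverse _ _ hsep, hflags, smul_eq_mul, sub_self]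

/-! ### The PCT identity of the holomorphic functions -/

/-- **The PCT identity of the holomorphic Wightman functions** (Streater–Wightman (1964), Thm. 4-7,
eq. (4-35) in basis-free form): on the forward tube,
`𝒲_k(z) = σ · (⊗ⱼ (pctMatrixⱼ · Sⱼ(−1))) 𝒲^{PCT}_k(z)`. [cite: StreaterWightman1964, §4-3 Thm 4-7] -/
theorem famRelFn_eq_pct (hW : IsSpinorWightmanQFT W) (Φ : Fin n → W.CovFamily) {z : Fin n → Fin (3 + 1) → ℂ} (hz : z ∈ forwardTube 3 n) :
    hW.famRelFn Φ z = fermiPairSign (List.ofFn fun j => (Φ j).fermi) •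
      matCLM (piMatrix fun j => SL2C.pctMatrix ((Φ j).R) ((Φ j).continuous_R) * (Φ j).R (-1)) (hW.pctHF Φ z) := by
  set S : (j : Fin n) → SL(2, ℂ) →* Matrix (Fin (Φ j).m) (Fin (Φ j).m) ℂ := fun j => (Φ j).R with hS
  have hSc : ∀ j, Continuous (S j) := fun j => (Φ j).continuous_R
  -- a box of right-wedge configurations
  obtain ⟨x₀, hx₀⟩ := TubeBoost.rightWedgeConfigs_nonempty (n := n)
  obtain ⟨ε, hε, hbox⟩ := exists_ball_box_subset_rightWedgeConfigs hx₀
  have hOo : IsOpen {x : Fin n → SpaceTime 3 | ∀ j, x j ∈ Metric.ball (x₀ j) ε} := by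
    rw [show {x : Fin n → SpaceTime 3 | ∀ j, x j ∈ Metric.ball (x₀ j) ε} = Metric.ball x₀ ε by
      rw [ball_pi _ hε]; ext x; simp]
    exact Metric.isOpen_ball
  have hOne : ({x : Fin n → SpaceTime 3 | ∀ j, x j ∈ Metric.ball (x₀ j) ε}).Nonempty :=
    ⟨x₀, fun j => Metric.mem_ball_self hε⟩
  have key := TubeBoost.pct_core_local (F := hW.famRelFn Φ) (H := hW.pctHF Φ) (hW.differentiableOn_famRelFn Φ)
    (hW.differentiableOn_pctHF Φ) (hW.hasDistributionalBoundaryValue_famRelFn Φ) (hW.hasDistributionalBoundaryValue_pctHF Φ)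
    (differentiable_boostGroup S hSc) (boostGroup_zero S hSc) (boostGroup_add S hSc)
    (fun χ z hz => hW.famRelFn_boostN Φ χ hz) (fun χ z hz => hW.pctHF_boostN Φ χ hz)
    (rotTensorInv_mul_rotTensor S) (fun z hz => hW.famRelFn_rot3N Φ hz) (boostGroup_mul_rotTensor S hSc)
    (fermiPairSign (List.ofFn fun j => (Φ j).fermi)) hOo hOne hbox
    (fun φ hφ hφO α => hW.famDist_reflect_eq_of_box Φ (fun j => Metric.isOpen_ball) (fun j => Metric.mem_ball_self hε) hbox φ hφ hφO α)
    hz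
  rw [key]
  congr 1
  show (boostGroup S hSc (-(π * I)) * rotTensorInv S) (hW.pctHF Φ z) = _
  rw [boostGroup_neg_pi_mul_I_mul_rotTensorInv S hSc]

/-! ### The PCT identity of the distributions -/

/-- **The PCT identity of the Wightman distributions, first form**:
`𝒲_{k,α} = σ ∑_β (⊗ⱼ (pctMatrixⱼ Sⱼ(−1)))_{αβ} 𝒲^{PCT}_{k,β}`. [cite: StreaterWightman1964, §4-3 Thm 4-7 eq. (4-19)] -/
theorem famDist_eq_pct' (hW : IsSpinorWightmanQFT W) (Φ : Fin n → W.CovFamily) (α : W.MIdxF Φ) (φ : 𝓢((Fin n → SpaceTime 3), ℂ)) :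
    hW.famDist Φ α φ = fermiPairSign (List.ofFn fun j => (Φ j).fermi) *
      ∑ β : W.MIdxF Φ, (piMatrix fun j => SL2C.pctMatrix ((Φ j).R) ((Φ j).continuous_R) * (Φ j).R (-1)) α β * hW.pctDistF Φ β φ := by
  set σ : ℂ := fermiPairSign (List.ofFn fun j => (Φ j).fermi) with hσ
  set C := piMatrix fun j => SL2C.pctMatrix ((Φ j).R) ((Φ j).continuous_R) * (Φ j).R (-1) with hC
  -- both sides are continuous in `φ`; prove it for compactly supported `φ` first
  set L : 𝓢((Fin n → SpaceTime 3), ℂ) →L[ℂ] ℂ := hW.famDist Φ α - σ • ∑ β : W.MIdxF Φ, C α β • hW.pctDistF Φ β with hL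
  suffices hL0 : L = 0 by
    have h := congrArg (fun T : 𝓢((Fin n → SpaceTime 3), ℂ) →L[ℂ] ℂ => T φ) hL0
    simp only [hL, sub_apply, zero_apply, sub_eq_zero, smul_apply, sum_apply, smul_eq_mul] at h
    exact h
  refine clm_eq_zero_of_forall_hasCompactSupport L fun ψ hψ => ?_
  -- along a ray the two boundary values are limits of equal integrals
  set η : Fin n → SpaceTime 3 := fun j => (((j : ℕ) : ℝ) + 1) • e₀ 3 with hη
  have hη' : η ∈ tubeCone 3 n := QuantumFieldTheory.stdDirection_mem_tubeCone
  have t₁ := hW.hasDistributionalBoundaryValue_famRelFn Φ α η hη' ψ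
  have t₃ : ∀ β, Tendsto (fun t : ℝ => ∫ x : Fin n → SpaceTime 3,
      hW.pctHF Φ (fun j => complexifyPoint (x j) + ((t : ℂ) * I) • complexifyPoint (η j)) β * ψ x)
      (𝓝[>] 0) (𝓝 (hW.pctDistF Φ β ψ)) := fun β => hW.hasDistributionalBoundaryValue_pctHF Φ β η hη' ψ
  have tsum : Tendsto (fun t : ℝ => σ * ∑ β, C α β * ∫ x : Fin n → SpaceTime 3,
      hW.pctHF Φ (fun j => complexifyPoint (x j) + ((t : ℂ) * I) • complexifyPoint (η j)) β * ψ x)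
      (𝓝[>] 0) (𝓝 (σ * ∑ β, C α β * hW.pctDistF Φ β ψ)) :=
    (tendsto_finsetSum _ fun β _ => (t₃ β).const_mul _).const_mul σ
  have heq : ∀ t : ℝ, 0 < t → ∫ x : Fin n → SpaceTime 3,
      hW.famRelFn Φ (fun j => complexifyPoint (x j) + ((t : ℂ) * I) • complexifyPoint (η j)) α * ψ x =
      σ * ∑ β, C α β * ∫ x : Fin n → SpaceTime 3,
        hW.pctHF Φ (fun j => complexifyPoint (x j) + ((t : ℂ) * I) • complexifyPoint (η j)) β * ψ x := by
    intro t ht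
    have hint : ∀ β, Integrable fun x : Fin n → SpaceTime 3 =>
        hW.pctHF Φ (fun j => complexifyPoint (x j) + ((t : ℂ) * I) • complexifyPoint (η j)) β * ψ x := fun β =>
      ((continuous_raySlice (differentiableOn_pi.1 (hW.differentiableOn_pctHF Φ) β) hη' ht).mul ψ.continuous).integrable_of_hasCompactSupport
        hψ.mul_left
    have e : ∀ β, C α β * ∫ x : Fin n → SpaceTime 3,
        hW.pctHF Φ (fun j => complexifyPoint (x j) + ((t : ℂ) * I) • complexifyPoint (η j)) β * ψ x =
        ∫ x : Fin n → SpaceTime 3, C α β *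
          (hW.pctHF Φ (fun j => complexifyPoint (x j) + ((t : ℂ) * I) • complexifyPoint (η j)) β * ψ x) :=
      fun β => (integral_const_mul _ _).symm
    simp_rw [e]
    rw [← integral_finsetSum _ (fun β _ => (hint β).const_mul _), ← integral_const_mul]
    refine integral_congr_ae (Eventually.of_forall fun x => ?_)
    have hzx : (fun j => complexifyPoint (x j) + ((t : ℂ) * I) • complexifyPoint (η j)) ∈ forwardTube 3 n :=
      mem_forwardTube_of_mem_tubeCone x η hη' ht
    have h := congrFun (hW.famRelFn_eq_pct Φ hzx) α
    simp only [Pi.smul_apply, smul_eq_mul] at h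
    beta_reduce
    rw [h, matCLM_apply_eq_sum, Finset.mul_sum, Finset.mul_sum, Finset.sum_mul]
    refine Finset.sum_congr rfl fun β _ => ?_
    ring
  have t₁' : Tendsto (fun t : ℝ => ∫ x : Fin n → SpaceTime 3,
      hW.famRelFn Φ (fun j => complexifyPoint (x j) + ((t : ℂ) * I) • complexifyPoint (η j)) α * ψ x)
      (𝓝[>] 0) (𝓝 (σ * ∑ β, C α β * hW.pctDistF Φ β ψ)) := by
    refine tsum.congr' ?_
    filter_upwards [self_mem_nhdsWithin] with t ht
    exact (heq t ht).symm
  have hval := tendsto_nhds_unique t₁ t₁'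
  simp only [hL, sub_apply, smul_apply, sum_apply, smul_eq_mul]
  rw [hval, sub_eq_zero]

/-- **A rotation by `2π` acts trivially on the PCT-transformed distributions**:
`∑_γ (⊗ⱼ Sⱼ(−1))_{βγ} 𝒲^{PCT}_{k,γ} = 𝒲^{PCT}_{k,β}`. [cite: StreaterWightman1964, §4-3 eq. (4-32)] -/
theorem sum_repTensor_neg_one_pctDistF (hW : IsSpinorWightmanQFT W) (Φ : Fin n → W.CovFamily) (β : W.MIdxF Φ) (φ : 𝓢((Fin n → SpaceTime 3), ℂ)) :
    ∑ γ : W.MIdxF Φ, repTensor (fun j => (Φ j).R) (-1) β γ * hW.pctDistF Φ γ φ = hW.pctDistF Φ β φ := by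
  have h := hW.famDist_comp_poincareTestMulti_inr (fun j => Φ (Fin.rev j)) (W.revMIdxF Φ β) (-1)
  rw [spinCoverHom_neg_one, map_one] at h
  have h' := congrArg (fun T : 𝓢((Fin n → SpaceTime 3), ℂ) →L[ℂ] ℂ => T (negRevTest φ)) h
  simp only [ContinuousLinearMap.comp_apply, poincareTestMulti_one, sum_apply, smul_apply, smul_eq_mul] at h'
  rw [pctDistF, ContinuousLinearMap.comp_apply, h', ← (W.revMIdxF Φ).sum_comp]
  refine Finset.sum_congr rfl fun γ _ => ?_
  simp only [repTensor_apply, revMIdxF_apply, pctDistF, ContinuousLinearMap.comp_apply]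
  rw [prod_rev_eq (fun i => (Φ i).R (-1) (β i) (γ i))]

/-- **The PCT identity of the Wightman distributions** (Streater–Wightman (1964), Thm. 4-7,
eq. (4-19), basis-free): `𝒲_{k,α} = σ ∑_β (⊗ⱼ pctMatrixⱼ)_{αβ} 𝒲^{PCT}_{k,β}`.
[cite: StreaterWightman1964, §4-3 Thm 4-7 eq. (4-19)] -/
theorem famDist_eq_pct (hW : IsSpinorWightmanQFT W) (Φ : Fin n → W.CovFamily) (α : W.MIdxF Φ) (φ : 𝓢((Fin n → SpaceTime 3), ℂ)) :
    hW.famDist Φ α φ = fermiPairSign (List.ofFn fun j => (Φ j).fermi) *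
      ∑ β : W.MIdxF Φ, (∏ j, SL2C.pctMatrix ((Φ j).R) ((Φ j).continuous_R) (α j) (β j)) * hW.pctDistF Φ β φ := by
  rw [hW.famDist_eq_pct' Φ α φ, piMatrix_pctMatrix_mul_neg_one]
  congr 1
  simp only [Matrix.mul_apply, Finset.sum_mul]
  rw [Finset.sum_comm]
  refine Finset.sum_congr rfl fun β _ => ?_
  simp only [mul_assoc, ← Finset.mul_sum, hW.sum_repTensor_neg_one_pctDistF Φ β φ, piMatrix_apply]

/-- **The PCT identity on tensor products of test functions, for family members**:
`𝒲_α(f) = σ ∑_β ∏ⱼ Cⱼ(αⱼ, βⱼ) 𝒲^{rev}_{β∘rev}(f̂ ∘ rev)`, `f̂(x) = f(−x)`, `Cⱼ = SL2C.pctMatrix Rⱼ`,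
`σ = (−1)^{F(F−1)/2}`. [cite: StreaterWightman1964, §4-3 Thm 4-7 eq. (4-19)] -/
theorem cWightmanFn_eq_pct (hW : IsSpinorWightmanQFT W) (Φ : Fin n → W.CovFamily) (α : W.MIdxF Φ) (f : Fin n → 𝓢(SpaceTime 3, ℂ)) :
    W.cWightmanFn n (fun j => (Φ j).idx (α j)) f = fermiPairSign (List.ofFn fun j => (Φ j).fermi) *
      ∑ β : W.MIdxF Φ, (∏ j, SL2C.pctMatrix (Φ j).R (Φ j).continuous_R (α j) (β j)) *
        W.cWightmanFn n (fun j => (Φ (Fin.rev j)).idx (β (Fin.rev j))) (fun j => reflectTest (f (Fin.rev j))) := by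
  have hG := isTensorOf_tensorFin (E := SpaceTime 3) f
  rw [← hW.famDist_apply_of_isTensorOf Φ α hG, hW.famDist_eq_pct Φ α]
  congr 1
  refine Finset.sum_congr rfl fun β _ => ?_
  rw [pctDistF, ContinuousLinearMap.comp_apply, hW.famDist_apply_of_isTensorOf _ _ hG.negRevTest]
  rfl

end IsSpinorWightmanQFT

end Literature.Analysis.FunctionSpaces
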